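import Summits.SmoothPoincare4.SmoothPoincare4.Theorems.ConvexBisectionAcyclicBisectionExistsChartedChainScale
import Summits.SmoothPoincare4.SmoothPoincare4.Theorems.ConvexBisectionAcyclicBisectionExistsChartedChainSymmetry
import Summits.SmoothPoincare4.SmoothPoincare4.Theorems.ConvexBisectionAcyclicBisectionExistsPageInvariance
import Literature.Topology.FourManifolds.LefschetzBaseShadow
import HarnessLib

/-!
# Sheet loops over the closed unit disc and their homology shadows
(wave 4, brick Y4-3a of the model chain (R2) `exists_charted_chain` for the missing lemma
`crossingNumber_eq_stdSymp` of node N1a of stub `stub_modelsOnFibred_of_reach` = NF4, line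
`modp-braid-orbits`, crux `ConvexBisection.AcyclicBisectionExists`, item stmt-SmoothPoincare4-10508;
registered sub-goal `helper_shadow_sheetLoop_chain`)

The `A_{2g}` chain loop `chainLoop g j` runs out along the chord `[ζ_j, ζ_{j+1}]` on the upper
sheet `y = +√(x^{2g+1} + 1)` and back on the lower sheet (principal root; continuous on the closed
unit disc, where `Re (x^{2g+1} + 1) ≥ 0`).  This file abstracts that shape: a SHEET LOOP is
`τ ↦ pagePt g c (x τ, ±√(x(τ)^{2g+1} + 1))` (`sheetAmb`; `+` on `[0, 1/2]`, `−` on `(1/2, 1]`) for an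
`x`-path in the closed unit disc returning at `τ = 1` to its start and passing through branch
points at `τ = 0, 1/2` (so that the sign switch is continuous), scaled to the page of direction `c`
(`‖c‖ ≤ 1`).

* §1 `toBase` (an ambient point read in the base, junk off the base) and the descent of a closed
  unit-period loop to a circle map (`exists_circleMap_of_loop`);
* §2 `sheetAmb`, its membership in the base / in `page g c`, and continuity of the two sheet
  formulas along continuous data (`continuousOn_pagePt_sheet`);
* §3 **`shadow_eq_of_sheet_family`**: a family of sheet loops whose `x`-paths and scales
  `s ↦ κ(s) c` move continuously has constant homology shadow (`shadow_eq_of_loop_family`);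
* §4 the chain loop IS a sheet loop at scale `0` over the chord zig-zag `chordZig g j`, so **a circle
  map tracing `sheetAmb g 0 τ (chordZig g j τ)` has shadow `chainVec g j`** (`j < 2g`;
  `helper_shadow_sheetLoop_chain`, Milnor's theorem `exists_isChainShadow_of`), and
  `ω^k · chordZig g i = chordZig g (i + k)`, `chordZig g (i + (2g+1)) = chordZig g i`.

Everything is proved; no `sorry`.  References: J. Milnor, *Singular points of complex
hypersurfaces* (1968), §9, Thm. 9.1 [Milnor1968]; A. Hatcher, *Algebraic Topology* (2002), Thm. 2A.1
[HatcherAT2002].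
-/

noncomputable section

set_option linter.dupNamespace false

open scoped Manifold ContDiff Topology ComplexConjugate Real unitInterval
open Set Function Metric Complex
open Literature.Topology.FourManifolds Literature.Topology.FourManifolds.LefschetzBase
  Literature.Topology.FourManifolds.TorusKnotMilnor Literature.AlgebraicTopology.SingularHomology

namespace Summit.SmoothPoincare4.SmoothPoincare4.Theorems.AcyclicBisectionExists.ModpBraidOrbits

variable {g : ℕ} {c : ℂ}

/-! ## §1 Reading ambient points in the base; descent of loops to circle maps -/

/-- **An ambient point read in the base** (junk `chordEnd g 0` off the base). [folklore] -/
def toBase (g : ℕ) (v : EuclideanSpace ℝ (Fin 4)) : Base g :=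
  if h : rho g v ≤ 1 / 4 then ⟨v, h⟩ else chordEnd g 0

/-- On the base `toBase` is the point itself. [folklore] -/
theorem toBase_val {v : EuclideanSpace ℝ (Fin 4)} (h : rho g v ≤ 1 / 4) : (toBase g v).1 = v := by
  rw [toBase, dif_pos h]

/-- **Continuity of `toBase ∘ F` on a set where `F` is continuous with values in the base.**
[folklore] -/
theorem continuousOn_toBase_comp {P : Type*} [TopologicalSpace P] {F : P → EuclideanSpace ℝ (Fin 4)}
    {S : Set P} (hF : ContinuousOn F S) (hS : ∀ p ∈ S, rho g (F p) ≤ 1 / 4) :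
    ContinuousOn (fun p => toBase g (F p)) S := by
  rw [(RegularSublevel.isEmbedding_incl (isRegularLevel_rho g)).continuousOn_iff]
  exact hF.congr fun p hp => toBase_val (hS p hp)

/-- **Descent of a closed unit-period loop to a circle map**: for `L` continuous on `[0, 1]` with
`L 0 = L 1` there is a continuous `K : 𝕊¹ → Base g` with `K (e^{2πiτ}) = L τ` on `[0, 1]`.
[cite: HatcherAT2002, §1.1] -/
theorem exists_circleMap_of_loop (L : ℝ → Base g) (hL : ContinuousOn L (Icc (0 : ℝ) 1))
    (h01 : L 0 = L 1) :
    ∃ K : sphere (0 : EuclideanSpace ℝ (Fin 2)) 1 → Base g, Continuous K ∧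
      ∀ τ ∈ Icc (0 : ℝ) 1, K (circlePt τ) = L τ := by
  let γ : C(I, Base g) := ⟨fun t => L t, hL.comp_continuous continuous_subtype_val fun t => t.2⟩
  have hγ : γ 0 = γ 1 := h01
  refine ⟨loopCircleMap γ hγ, (loopCircleMap γ hγ).continuous, fun τ hτ => ?_⟩
  have e : circlePt τ = circleParam ⟨τ, hτ⟩ := rfl
  rw [e, loopCircleMap_circleParam]
  rfl

/-! ## §2 Sheet points -/

/-- The sign of the half: `+1` on `[0, 1/2]`, `−1` beyond. [folklore] -/
def halfSign (τ : ℝ) : ℂ := if τ ≤ 1 / 2 then 1 else -1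

/-- `halfSign² = 1`. [folklore] -/
theorem halfSign_sq (τ : ℝ) : halfSign τ ^ 2 = 1 := by
  unfold halfSign; split_ifs <;> norm_num

/-- **The sheet point** over `x` at parameter `τ` and scale `c`:
`pagePt g c (x, halfSign τ · √(x^{2g+1} + 1))`. [cite: Milnor1968, §9] -/
def sheetAmb (g : ℕ) (c : ℂ) (τ : ℝ) (x : ℂ) : EuclideanSpace ℝ (Fin 4) :=
  pagePt g c x (halfSign τ * csqrt (x ^ (2 * g + 1) + 1))

/-- The `y` of a sheet point squares to `x^{2g+1} + 1`. [folklore] -/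
theorem sheet_y_sq (g : ℕ) (ε x : ℂ) (hε : ε ^ 2 = 1) :
    (ε * csqrt (x ^ (2 * g + 1) + 1)) ^ 2 = x ^ (2 * g + 1) + 1 := by
  rw [mul_pow, hε, csqrt_sq, one_mul]

/-- `‖x‖ ≤ 1` gives `‖x‖² < 16/9`. [folklore] -/
theorem norm_sq_lt_of_norm_le_one {x : ℂ} (hx : ‖x‖ ≤ 1) : ‖x‖ ^ 2 < 16 / 9 := by
  nlinarith [norm_nonneg x]

/-- A scaled sheet point over the closed unit disc lies in the base. [folklore] -/
theorem rho_pagePt_sheet_le (hc : ‖c‖ ≤ 1) {ε x : ℂ} (hε : ε ^ 2 = 1) (hx : ‖x‖ ≤ 1) :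
    rho g (pagePt g c x (ε * csqrt (x ^ (2 * g + 1) + 1))) ≤ 1 / 4 :=
  rho_pagePt_le hc (sheet_y_sq g ε x hε) (norm_sq_lt_of_norm_le_one hx)

/-- **The sheet point lies in the base.** [folklore] -/
theorem rho_sheetAmb_le (hc : ‖c‖ ≤ 1) (τ : ℝ) {x : ℂ} (hx : ‖x‖ ≤ 1) : rho g (sheetAmb g c τ x) ≤ 1 / 4 :=
  rho_pagePt_sheet_le hc (halfSign_sq τ) hx

/-- **The sheet point lies in the page of direction `c`.** [folklore] -/
theorem toBase_sheetAmb_mem_page (hc : ‖c‖ ≤ 1) (τ : ℝ) {x : ℂ} (hx : ‖x‖ ≤ 1) :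
    toBase g (sheetAmb g c τ x) ∈ page g c := by
  have h := helper_pagePt_mem_page g c hc x _ (sheet_y_sq g _ x (halfSign_sq τ)) (norm_sq_lt_of_norm_le_one hx)
  have e : toBase g (sheetAmb g c τ x) = ⟨sheetAmb g c τ x, rho_sheetAmb_le hc τ hx⟩ :=
    Subtype.ext (toBase_val (rho_sheetAmb_le hc τ hx))
  rw [e]; exact h

/-- At a branch point the two sheets meet: the sheet point does not depend on the sign. [folklore] -/
theorem pagePt_sheet_branch {x : ℂ} (hx : x ^ (2 * g + 1) + 1 = 0) (ε ε' : ℂ) :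
    pagePt g c x (ε * csqrt (x ^ (2 * g + 1) + 1)) = pagePt g c x (ε' * csqrt (x ^ (2 * g + 1) + 1)) := by
  rw [hx, csqrt_zero, mul_zero, mul_zero]

/-- **Continuity of a sheet formula along continuous data**: `p ↦ pagePt g (κ(p) c) (X p,
ε √(X(p)^{2g+1} + 1))` is continuous on a set where `κ`, `X` are continuous, `|κ| ≤ 1` and
`‖X‖ ≤ 1` (the radicand has non-negative real part on the closed unit disc). [folklore] -/
theorem continuousOn_pagePt_sheet {P : Type*} [TopologicalSpace P] {S : Set P} {κ : P → ℝ}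
    {X : P → ℂ} (hc : ‖c‖ ≤ 1) (hκ : ContinuousOn κ S) (hκ1 : ∀ p ∈ S, |κ p| ≤ 1)
    (hX : ContinuousOn X S) (hX1 : ∀ p ∈ S, ‖X p‖ ≤ 1) (ε : ℂ) :
    ContinuousOn (fun p => pagePt g ((κ p : ℂ) * c) (X p) (ε * csqrt (X p ^ (2 * g + 1) + 1))) S := by
  intro p hp
  have h1 : ContinuousWithinAt (fun q => scaleX g ((κ q : ℂ) * c)) S p :=
    (continuousAt_scaleX_smul hc (hκ1 p hp)).comp_continuousWithinAt (hκ p hp)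
  have h2 : ContinuousWithinAt (fun q => scaleY ((κ q : ℂ) * c)) S p :=
    (continuousAt_scaleY_smul hc (hκ1 p hp)).comp_continuousWithinAt (hκ p hp)
  have h3 : ContinuousWithinAt (fun q => csqrt (X q ^ (2 * g + 1) + 1)) S p :=
    ContinuousAt.comp_continuousWithinAt (g := csqrt) (f := fun q => X q ^ (2 * g + 1) + 1)
      (continuousAt_csqrt (re_pow_add_one_nonneg g (hX1 p hp)))
      (((hX p hp).pow _).add continuousWithinAt_const)
  unfold pagePt
  exact continuous_mk.continuousAt.comp_continuousWithinAt
    ((h1.mul (hX p hp)).prodMk (h2.mul (continuousWithinAt_const.mul h3)))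

/-- Every point of the circle is `e^{2πiτ}` for some `τ ∈ [0, 1]`. [folklore] -/
theorem exists_Icc_circlePt_eq (θ : sphere (0 : EuclideanSpace ℝ (Fin 2)) 1) : ∃ τ ∈ Icc (0 : ℝ) 1, circlePt τ = θ := by
  obtain ⟨t, rfl⟩ := circleParam_surjective θ
  exact ⟨t, t.2, rfl⟩

/-- **The sheet loop of an `x`-path as a circle map in the page**: for `x` continuous on `[0, 1]`
with values in the closed unit disc, closed, and through branch points at `τ = 0, 1/2`, there is a
continuous `K : 𝕊¹ → page g c` tracing `τ ↦ sheetAmb g c τ (x τ)`. [cite: Milnor1968, §9] -/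
theorem exists_sheetCircle (hc : ‖c‖ ≤ 1) (x : ℝ → ℂ) (hx : ContinuousOn x (Icc (0 : ℝ) 1))
    (hx1 : ∀ τ ∈ Icc (0 : ℝ) 1, ‖x τ‖ ≤ 1) (hcl : x 0 = x 1) (hb0 : x 0 ^ (2 * g + 1) + 1 = 0)
    (hbh : x (1 / 2) ^ (2 * g + 1) + 1 = 0) :
    ∃ K : sphere (0 : EuclideanSpace ℝ (Fin 2)) 1 → Base g, Continuous K ∧
      (∀ τ ∈ Icc (0 : ℝ) 1, (K (circlePt τ)).1 = sheetAmb g c τ (x τ)) ∧ ∀ θ, K θ ∈ page g c := by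
  have hFe : ∀ ε : ℂ, ContinuousOn (fun τ => pagePt g (((1 : ℝ) : ℂ) * c) (x τ) (ε * csqrt (x τ ^ (2 * g + 1) + 1)))
      (Icc (0 : ℝ) 1) := fun ε =>
    continuousOn_pagePt_sheet hc continuousOn_const (fun _ _ => by norm_num) hx hx1 ε
  simp only [Complex.ofReal_one, one_mul] at hFe
  have hF : ContinuousOn (fun τ => sheetAmb g c τ (x τ)) (Icc (0 : ℝ) 1) := by
    rw [← Icc_union_Icc_eq_Icc (show (0 : ℝ) ≤ 1 / 2 by norm_num) (show (1 / 2 : ℝ) ≤ 1 by norm_num)]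
    refine ContinuousOn.union_of_isClosed ?_ ?_ isClosed_Icc isClosed_Icc
    · refine ((hFe 1).mono (Icc_subset_Icc le_rfl (by norm_num))).congr fun τ hτ => ?_
      simp only [sheetAmb, halfSign, if_pos hτ.2]
    · refine ((hFe (-1)).mono (Icc_subset_Icc (by norm_num) le_rfl)).congr fun τ hτ => ?_
      by_cases h : τ ≤ 1 / 2
      · have h12 : τ = 1 / 2 := le_antisymm h hτ.1
        simp only [sheetAmb, halfSign, if_pos h]
        rw [h12]; exact pagePt_sheet_branch hbh _ _
      · simp only [sheetAmb, halfSign, if_neg h]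
  have hL : ContinuousOn (fun τ => toBase g (sheetAmb g c τ (x τ))) (Icc (0 : ℝ) 1) :=
    continuousOn_toBase_comp hF fun τ hτ => rho_sheetAmb_le hc τ (hx1 τ hτ)
  have h01 : toBase g (sheetAmb g c 0 (x 0)) = toBase g (sheetAmb g c 1 (x 1)) := by
    congr 1
    simp only [sheetAmb, halfSign, ← hcl]
    exact pagePt_sheet_branch hb0 _ _
  obtain ⟨K, hK, hKτ⟩ := exists_circleMap_of_loop _ hL h01
  refine ⟨K, hK, fun τ hτ => by rw [hKτ τ hτ, toBase_val (rho_sheetAmb_le hc τ (hx1 τ hτ))], fun θ => ?_⟩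
  obtain ⟨τ, hτ, rfl⟩ := exists_Icc_circlePt_eq θ
  rw [hKτ τ hτ]
  exact toBase_sheetAmb_mem_page hc τ (hx1 τ hτ)

/-! ## §3 Families of sheet loops have constant shadow -/

variable {K K' : sphere (0 : EuclideanSpace ℝ (Fin 2)) 1 → Base g}

/-- **A family of sheet loops has constant homology shadow.**  Data: scales `κ s · c`
(`κ` continuous, `|κ| ≤ 1` on `[0,1]`) and `x`-paths `X s` in the closed unit disc, jointly
continuous on `[0,1]²`, closed (`X s 0 = X s 1`) and through branch points at `τ = 0` and
`τ = 1/2`; if `K` traces the sheet loop of `(κ 0, X 0)` and `K'` that of `(κ 1, X 1)`, then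
`shadow K = shadow K'`. [cite: HatcherAT2002, Thm. 2A.1] -/
theorem shadow_eq_of_sheet_family (hc : ‖c‖ ≤ 1) (κ : ℝ → ℝ) (hκ : ContinuousOn κ (Icc (0 : ℝ) 1))
    (hκ1 : ∀ s ∈ Icc (0 : ℝ) 1, |κ s| ≤ 1) (X : ℝ → ℝ → ℂ)
    (hX : ContinuousOn (uncurry X) (Icc (0 : ℝ) 1 ×ˢ Icc (0 : ℝ) 1))
    (hX1 : ∀ s ∈ Icc (0 : ℝ) 1, ∀ τ ∈ Icc (0 : ℝ) 1, ‖X s τ‖ ≤ 1)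
    (hcl : ∀ s ∈ Icc (0 : ℝ) 1, X s 0 = X s 1)
    (hb0 : ∀ s ∈ Icc (0 : ℝ) 1, X s 0 ^ (2 * g + 1) + 1 = 0)
    (hbh : ∀ s ∈ Icc (0 : ℝ) 1, X s (1 / 2) ^ (2 * g + 1) + 1 = 0)
    (hK : Continuous K) (hK' : Continuous K')
    (e0 : ∀ τ ∈ Icc (0 : ℝ) 1, (K (circlePt τ)).1 = sheetAmb g ((κ 0 : ℂ) * c) τ (X 0 τ))
    (e1 : ∀ τ ∈ Icc (0 : ℝ) 1, (K' (circlePt τ)).1 = sheetAmb g ((κ 1 : ℂ) * c) τ (X 1 τ)) :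
    shadow g K hK = shadow g K' hK' := by
  have hsc : ∀ s ∈ Icc (0 : ℝ) 1, ‖(κ s : ℂ) * c‖ ≤ 1 := fun s hs => by
    rw [norm_mul, Complex.norm_real, Real.norm_eq_abs]; nlinarith [hκ1 s hs, norm_nonneg c, abs_nonneg (κ s)]
  -- the family and its two sheet formulas
  let F : ℝ × ℝ → EuclideanSpace ℝ (Fin 4) := fun p => sheetAmb g ((κ p.1 : ℂ) * c) p.2 (X p.1 p.2)
  let Fe : ℂ → ℝ × ℝ → EuclideanSpace ℝ (Fin 4) := fun ε p =>
    pagePt g ((κ p.1 : ℂ) * c) (X p.1 p.2) (ε * csqrt (X p.1 p.2 ^ (2 * g + 1) + 1))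
  have hFe : ∀ ε, ContinuousOn (Fe ε) (Icc (0 : ℝ) 1 ×ˢ Icc (0 : ℝ) 1) := fun ε =>
    continuousOn_pagePt_sheet hc (hκ.comp continuousOn_fst fun p hp => hp.1)
      (fun p hp => hκ1 p.1 hp.1) hX (fun p hp => hX1 p.1 hp.1 p.2 hp.2) ε
  have hlo : Icc (0 : ℝ) 1 ×ˢ Icc (0 : ℝ) (1 / 2) ⊆ Icc (0 : ℝ) 1 ×ˢ Icc (0 : ℝ) 1 :=
    prod_mono le_rfl (Icc_subset_Icc le_rfl (by norm_num))
  have hhi : Icc (0 : ℝ) 1 ×ˢ Icc (1 / 2 : ℝ) 1 ⊆ Icc (0 : ℝ) 1 ×ˢ Icc (0 : ℝ) 1 :=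
    prod_mono le_rfl (Icc_subset_Icc (by norm_num) le_rfl)
  have hF : ContinuousOn F (Icc (0 : ℝ) 1 ×ˢ Icc (0 : ℝ) 1) := by
    have e : Icc (0 : ℝ) 1 ×ˢ Icc (0 : ℝ) 1 =
        Icc (0 : ℝ) 1 ×ˢ Icc (0 : ℝ) (1 / 2) ∪ Icc (0 : ℝ) 1 ×ˢ Icc (1 / 2 : ℝ) 1 := by
      rw [← prod_union, Icc_union_Icc_eq_Icc (by norm_num) (by norm_num)]
    rw [e]
    refine ContinuousOn.union_of_isClosed ?_ ?_ (isClosed_Icc.prod isClosed_Icc) (isClosed_Icc.prod isClosed_Icc)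
    · refine ((hFe 1).mono hlo).congr fun p hp => ?_
      show sheetAmb g _ p.2 _ = Fe 1 p
      simp only [sheetAmb, halfSign, if_pos hp.2.2, Fe]
    · refine ((hFe (-1)).mono hhi).congr fun p hp => ?_
      show sheetAmb g _ p.2 _ = Fe (-1) p
      by_cases h : p.2 ≤ 1 / 2
      · have h12 : p.2 = 1 / 2 := le_antisymm h hp.2.1
        simp only [sheetAmb, halfSign, if_pos h, Fe]
        rw [h12]
        exact pagePt_sheet_branch (hbh p.1 hp.1) _ _
      · simp only [sheetAmb, halfSign, if_neg h, Fe]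
  have hmem : ∀ p ∈ Icc (0 : ℝ) 1 ×ˢ Icc (0 : ℝ) 1, rho g (F p) ≤ 1 / 4 := fun p hp =>
    rho_sheetAmb_le (hsc p.1 hp.1) p.2 (hX1 p.1 hp.1 p.2 hp.2)
  refine shadow_eq_of_loop_family hK hK' (fun s τ => toBase g (F (s, τ))) ?_ ?_ ?_ ?_
  · exact continuousOn_toBase_comp (hF.comp (f := fun p : ℝ × ℝ => (p.1, p.2)) continuousOn_id
      (fun p hp => by simpa using hp)) (fun p hp => hmem _ (by simpa using hp))
  · intro s hs
    apply Subtype.ext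
    have h0 : ((s, (0 : ℝ)) : ℝ × ℝ) ∈ Icc (0 : ℝ) 1 ×ˢ Icc (0 : ℝ) 1 := ⟨hs, by norm_num, by norm_num⟩
    have h1 : ((s, (1 : ℝ)) : ℝ × ℝ) ∈ Icc (0 : ℝ) 1 ×ˢ Icc (0 : ℝ) 1 := ⟨hs, by norm_num, by norm_num⟩
    rw [toBase_val (hmem _ h0), toBase_val (hmem _ h1)]
    show sheetAmb g _ 0 (X s 0) = sheetAmb g _ 1 (X s 1)
    simp only [sheetAmb, halfSign, ← hcl s hs]
    exact pagePt_sheet_branch (hb0 s hs) _ _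
  · intro τ hτ
    apply Subtype.ext
    rw [toBase_val (hmem _ ⟨⟨le_rfl, zero_le_one⟩, hτ⟩), e0 τ hτ]
  · intro τ hτ
    apply Subtype.ext
    rw [toBase_val (hmem _ ⟨⟨zero_le_one, le_rfl⟩, hτ⟩), e1 τ hτ]

/-! ## §4 The chain loops are sheet loops at scale `0` -/

/-- The branch points have period `2g+1` in the index. [folklore] -/
theorem branchPt_add_period (g k : ℕ) : branchPt g (k + (2 * g + 1)) = branchPt g k := by
  rw [branchPt_eq_halfRoot_mul, branchPt_eq_halfRoot_mul, pow_add, rootU_pow_self (Nat.succ_ne_zero _),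
    mul_one]

/-- `ω^k · chordX g i = chordX g (i + k)`. [folklore] -/
theorem rootU_pow_mul_chordX (g k i : ℕ) (s : ℝ) :
    rootU (2 * g + 1) ^ k * chordX g i s = chordX g (i + k) s := by
  simp only [chordX, branchPt_eq_halfRoot_mul, pow_add]; ring

/-- `chordX` has period `2g+1` in the index. [folklore] -/
theorem chordX_add_period (g i : ℕ) (s : ℝ) : chordX g (i + (2 * g + 1)) s = chordX g i s := by
  simp only [chordX, show i + (2 * g + 1) + 1 = (i + 1) + (2 * g + 1) by ring, branchPt_add_period]

/-- **The chord zig-zag**: out along the `i`-th chord on `[0, 1/2]`, back on `[1/2, 1]`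
(double speed, the parametrisation of `chainLoop`). [folklore] -/
def chordZig (g i : ℕ) (τ : ℝ) : ℂ := if τ ≤ 1 / 2 then chordX g i (2 * τ) else chordX g i (2 - 2 * τ)

/-- `ω^k · chordZig g i = chordZig g (i + k)`. [folklore] -/
theorem rootU_pow_mul_chordZig (g k i : ℕ) (τ : ℝ) :
    rootU (2 * g + 1) ^ k * chordZig g i τ = chordZig g (i + k) τ := by
  unfold chordZig; split_ifs <;> exact rootU_pow_mul_chordX g k i _

/-- `chordZig` has period `2g+1` in the index. [folklore] -/
theorem chordZig_add_period (g i : ℕ) (τ : ℝ) : chordZig g (i + (2 * g + 1)) τ = chordZig g i τ := by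
  unfold chordZig; split_ifs <;> exact chordX_add_period g i _

/-- The zig-zag stays in the closed unit disc on `[0, 1]`. [folklore] -/
theorem norm_chordZig_le (g i : ℕ) {τ : ℝ} (hτ : τ ∈ Icc (0 : ℝ) 1) : ‖chordZig g i τ‖ ≤ 1 := by
  unfold chordZig
  split_ifs with h
  · exact norm_chordX_le g i ⟨by linarith [hτ.1], by linarith⟩
  · exact norm_chordX_le g i ⟨by linarith [hτ.2], by linarith [not_le.1 h]⟩

/-- The zig-zag is continuous (the two halves agree at `τ = 1/2`). [folklore] -/
theorem continuous_chordZig (g i : ℕ) : Continuous (chordZig g i) := by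
  unfold chordZig
  refine Continuous.if_le ((continuous_chordX g i).comp (by fun_prop))
    ((continuous_chordX g i).comp (by fun_prop)) continuous_id continuous_const fun τ hτ => ?_
  rw [hτ]; norm_num

/-- End points and midpoint of the zig-zag are the branch points `ζ_i`, `ζ_{i+1}`. [folklore] -/
theorem chordZig_ends (g i : ℕ) :
    chordZig g i 0 = branchPt g i ∧ chordZig g i 1 = branchPt g i ∧ chordZig g i (1 / 2) = branchPt g (i + 1) := by
  unfold chordZig
  refine ⟨by norm_num, by norm_num, by norm_num⟩

/-- **The chain loop is the sheet loop at scale `0` over the chord zig-zag.** [folklore] -/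
theorem chainLoop_val_eq_sheetAmb (g i : ℕ) (t : I) :
    (chainLoop g i t).1 = sheetAmb g 0 (t : ℝ) (chordZig g i t) := by
  rw [chainLoop, Path.trans_apply]
  simp only [sheetAmb, pagePt, scaleX_zero, scaleY_zero, one_mul, halfSign, chordZig]
  split_ifs with h
  · rfl
  · rw [Path.symm_apply]
    show chordLift g i (-1) (1 - (2 * (t : ℝ) - 1)) = _
    rw [show (1 - (2 * (t : ℝ) - 1)) = 2 - 2 * (t : ℝ) by ring, chordLift, neg_one_mul]

/-- **Sub-goal `helper_shadow_sheetLoop_chain`** (Y4-3a of the model chain (R2) for node N1a of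
NF4): a circle map tracing on `[0, 1]` the sheet loop at scale `0` over the `j`-th chord zig-zag —
i.e. the `j`-th chain loop — has homology shadow `chainVec g j` (`j < 2g`; Milnor's theorem
`exists_isChainShadow_of`). [cite: Milnor1968, Thm. 9.1] -/
theorem helper_shadow_sheetLoop_chain : ∀ (g j : ℕ) (_hj : j < 2 * g) (K : Metric.sphere (0 : EuclideanSpace ℝ (Fin 2)) 1 → Literature.Topology.FourManifolds.LefschetzBase.Base g) (hK : Continuous K), (∀ τ ∈ Set.Icc (0 : ℝ) 1, (K (Literature.Topology.FourManifolds.circlePt τ)).1 = Summit.SmoothPoincare4.SmoothPoincare4.Theorems.AcyclicBisectionExists.ModpBraidOrbits.sheetAmb g 0 τ (Summit.SmoothPoincare4.SmoothPoincare4.Theorems.AcyclicBisectionExists.ModpBraidOrbits.chordZig g j τ)) → Literature.Topology.FourManifolds.LefschetzBase.shadow g K hK = Literature.Topology.FourManifolds.LefschetzBase.chainVec g j := by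
  intro g j hj K hK hKτ
  have hσ := isChainShadow_shadowMap g (exists_isChainShadow_of g)
  unfold shadow
  rw [← hσ.2 j hj]
  congr 1
  refine loopClass_eq_of_ofPath_eq _ _ _ _ _ ?_
  apply SingularSimplex.toContinuousMap_injective
  ext s : 1
  rw [SingularSimplex.ofPath_apply, SingularSimplex.ofPath_apply]
  show K (circlePt _) = chainLoop g j _
  apply Subtype.ext
  exact (hKτ _ (Subtype.prop _)).trans (chainLoop_val_eq_sheetAmb g j _).symm

/-- **The chain loop as a circle map**: a continuous `K` tracing the `j`-th chain loop, with
shadow `chainVec g j` (`j < 2g`). [cite: Milnor1968, Thm. 9.1] -/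
theorem exists_chainCircle (g j : ℕ) :
    ∃ K : sphere (0 : EuclideanSpace ℝ (Fin 2)) 1 → Base g, Continuous K ∧
      ∀ τ ∈ Icc (0 : ℝ) 1, (K (circlePt τ)).1 = sheetAmb g 0 τ (chordZig g j τ) := by
  refine ⟨pathCircleMap (chainLoop g j), (pathCircleMap (chainLoop g j)).continuous, fun τ hτ => ?_⟩
  have e : circlePt τ = circleParam ⟨τ, hτ⟩ := rfl
  rw [e, pathCircleMap_circleParam, chainLoop_val_eq_sheetAmb]

end Summit.SmoothPoincare4.SmoothPoincare4.Theorems.AcyclicBisectionExists.ModpBraidOrbits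

end
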